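import Summits.QuantumFields.YangMills.Theorems.F4SubCurvatureDoorHarmonicGaussianSlices
import Literature.Analysis.Fourier.HeckeIdentityDeriv
import Mathlib
import HarnessLib

/-!
# Route `F4SubCurvatureDoor`, crux ⟨stmt-QuantumFields-23125⟩ `RationalToGeneral`: LINE g18-A v5 — CSF build plan C3a:
# the SPATIAL LAPLACIAN of a harmonic–Gaussian probe becomes `−|q⃗|²` on the Laplace–Fourier side

For an abstract Laplace–Fourier pair `(k, μ)` on `ℝ³` (`k(z⃗) = ∫ e^{−tE} cos⟪q⃗, z⃗⟫ dμ`, `e^{−tE}` `μ`-integrable) and `Y` harmonic homogeneous of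
degree `j` on `ℝ³`, `a > 0`, the function `Δ_z⃗ (Y(z⃗) e^{−a‖z⃗‖²}) = Y(z⃗)·(4a²‖z⃗‖² − 2a(2j+3))·e^{−a‖z⃗‖²}` (Euler + `ΔY = 0`) satisfies

  ★ `integral_laplacianHarmonicGaussian_smeared_eq`:
    `∫ k(z⃗) · Y(z⃗)(4a²‖z⃗‖² − 2a(2j+3)) e^{−a‖z⃗‖²} dz⃗ = −π^{3/2} Re((−i/2)^j) a^{−(3/2+j)} ∫ e^{−tE} ‖q⃗‖² Y(q⃗) e^{−‖q⃗‖²/(4a)} dμ(E, q⃗)`,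

i.e. pairing the slice with the Laplacian of a harmonic–Gaussian probe tests `μ_t` against `−‖q⃗‖²` times the dual probe: the `Δ_z⃗ ↔ −|q⃗|²` half
of `Δ₄ ↔ E² − |q⃗|²` (the time half `∂_t² ↔ E²` is ✓`F4SubCurvatureDoorSmearedSlices.hasDerivAt_integral_pow_mul_exp_mul`).  Ingredients:
✓`integral_smeared_eq` (Fubini), ✓`Literature.Analysis.Fourier.integral_eval_mul_exp_mul_cos'` and
✓`Literature.Analysis.Fourier.integral_sq_norm_mul_eval_mul_exp_mul_cos` (Hecke's identity and its `b`-derivative).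
The identification of the bracket with `Δ_z⃗(Y e^{−a‖z⃗‖²})` is classical calculus left to the consumer (it is not needed for the identity).

THEOREMS ONLY; Mathlib + tree; no `sorry`; standard axioms.  HONEST LABEL: Fourier bookkeeping for an OPEN XL stub; nothing here bears on C3,
T1″, ⟨23125⟩ / ⟨23035⟩, rung R2d or the summit; the Yang–Mills mass gap is NOT proved; no summit is proved by a line.
Seat `ym-line-frs-p2` g14 (free hands), `--supports stmt-QuantumFields-23125`. [cite: SteinWeiss1971, Ch. IV Thm. 3.4]
-/

set_option autoImplicit false

noncomputable section

namespace Summit.QuantumFields.YangMills.Theorems.F4SubCurvatureDoorLaplacianGaussianSlices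

open MvPolynomial MeasureTheory
open scoped BigOperators RealInnerProductSpace
open Summit.QuantumFields.YangMills.Theorems.F4SubCurvatureDoorSmearedSlices (integral_smeared_eq)
open Summit.QuantumFields.YangMills.Theorems.F4SubCurvatureDoorHarmonicGaussianSlices (integrable_eval_mul_exp)
open Literature.Analysis.Fourier (integral_eval_mul_exp_mul_cos' integral_sq_norm_mul_eval_mul_exp_mul_cos)

/-- ★ **The spatial Laplacian of a harmonic–Gaussian probe becomes `−|q⃗|²` on the Laplace–Fourier side.**  See the module docstring.
[cite: SteinWeiss1971, Ch. IV Thm. 3.4] -/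
theorem integral_laplacianHarmonicGaussian_smeared_eq (μ : Measure (ℝ × EuclideanSpace ℝ (Fin 3))) (t : ℝ)
    (hint : Integrable (fun p : ℝ × EuclideanSpace ℝ (Fin 3) => Real.exp (-(t * p.1))) μ)
    (k : EuclideanSpace ℝ (Fin 3) → ℝ)
    (hk : ∀ z, k z = ∫ p, Real.exp (-(t * p.1)) * Real.cos (inner ℝ p.2 z) ∂μ)
    (Y : MvPolynomial (Fin 3) ℝ) {j : ℕ} (hYj : Y.IsHomogeneous j) (hY : ∑ i, pderiv i (pderiv i Y) = 0)
    {a : ℝ} (ha : 0 < a) :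
    ∫ z : EuclideanSpace ℝ (Fin 3), k z *
        (eval (WithLp.ofLp z) Y * (4 * a ^ 2 * ‖z‖ ^ 2 - 2 * a * (2 * j + 3)) * Real.exp (-(a * ‖z‖ ^ 2)))
      = -(Real.pi ^ (3 / 2 : ℝ) * ((-Complex.I / 2) ^ j).re * a ^ (-((3 : ℝ) / 2 + j))) *
          ∫ p, Real.exp (-(t * p.1)) * (‖p.2‖ ^ 2 * eval (WithLp.ofLp p.2) Y * Real.exp (-(‖p.2‖ ^ 2 / (4 * a)))) ∂μ := by
  -- the probe is a polynomial times a Gaussian, hence integrable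
  set P : MvPolynomial (Fin 3) ℝ := Y * (C (4 * a ^ 2) * (∑ i, X i ^ 2) - C (2 * a * (2 * j + 3))) with hP
  have hPeval : ∀ z : EuclideanSpace ℝ (Fin 3),
      eval (WithLp.ofLp z) P = eval (WithLp.ofLp z) Y * (4 * a ^ 2 * ‖z‖ ^ 2 - 2 * a * (2 * j + 3)) := by
    intro z
    have h1 : eval (WithLp.ofLp z) (∑ i : Fin 3, (X i : MvPolynomial (Fin 3) ℝ) ^ 2) = ‖z‖ ^ 2 := by
      rw [EuclideanSpace.real_norm_sq_eq, map_sum]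
      simp [map_pow, eval_X]
    rw [hP, map_mul (eval (WithLp.ofLp z)), map_sub, map_mul (eval (WithLp.ofLp z)), eval_C, eval_C, h1]
  have hφint : Integrable (fun z : EuclideanSpace ℝ (Fin 3) =>
      eval (WithLp.ofLp z) Y * (4 * a ^ 2 * ‖z‖ ^ 2 - 2 * a * (2 * j + 3)) * Real.exp (-(a * ‖z‖ ^ 2))) := by
    refine (integrable_eval_mul_exp P ha).congr (Filter.Eventually.of_forall fun z => ?_)
    simp only [hPeval]
  rw [integral_smeared_eq μ t hint k hk _ hφint]
  -- the momentum weight `Φ(q) = 4a² · S(q) − 2a(2j+3) · C(q)` by the two Hecke identities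
  have hΦ : ∀ q : EuclideanSpace ℝ (Fin 3),
      ∫ z : EuclideanSpace ℝ (Fin 3), Real.cos (inner ℝ q z) *
          (eval (WithLp.ofLp z) Y * (4 * a ^ 2 * ‖z‖ ^ 2 - 2 * a * (2 * j + 3)) * Real.exp (-(a * ‖z‖ ^ 2)))
        = -(Real.pi ^ (3 / 2 : ℝ) * ((-Complex.I / 2) ^ j).re * a ^ (-((3 : ℝ) / 2 + j))) *
            (‖q‖ ^ 2 * eval (WithLp.ofLp q) Y * Real.exp (-(‖q‖ ^ 2 / (4 * a)))) := by
    intro q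
    have hS := integral_sq_norm_mul_eval_mul_exp_mul_cos Y hYj hY ha q
    have hC := integral_eval_mul_exp_mul_cos' Y hYj hY ha q
    simp only [Nat.cast_ofNat] at hS hC
    -- split the integrand
    have hsplit : ∀ z : EuclideanSpace ℝ (Fin 3), Real.cos (inner ℝ q z) *
        (eval (WithLp.ofLp z) Y * (4 * a ^ 2 * ‖z‖ ^ 2 - 2 * a * (2 * j + 3)) * Real.exp (-(a * ‖z‖ ^ 2)))
        = (4 * a ^ 2) * (‖z‖ ^ 2 * eval (WithLp.ofLp z) Y * Real.exp (-(a * ‖z‖ ^ 2)) * Real.cos (inner ℝ q z))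
          - (2 * a * (2 * j + 3)) * (eval (WithLp.ofLp z) Y * Real.exp (-(a * ‖z‖ ^ 2)) * Real.cos (inner ℝ q z)) := by
      intro z; ring
    have hI1 : Integrable (fun z : EuclideanSpace ℝ (Fin 3) =>
        ‖z‖ ^ 2 * eval (WithLp.ofLp z) Y * Real.exp (-(a * ‖z‖ ^ 2)) * Real.cos (inner ℝ q z)) := by
      have h := integrable_eval_mul_exp ((∑ i, X i ^ 2) * Y) ha
      have hc : Continuous fun z : EuclideanSpace ℝ (Fin 3) =>
          ‖z‖ ^ 2 * eval (WithLp.ofLp z) Y * Real.exp (-(a * ‖z‖ ^ 2)) * Real.cos (inner ℝ q z) :=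
        ((((by fun_prop : Continuous fun z : EuclideanSpace ℝ (Fin 3) => ‖z‖ ^ 2).mul
          (Literature.Topology.FourManifolds.contDiff_mvPolynomial_eval_ofLp Y (N := 0)).continuous).mul
          (by fun_prop)).mul (by fun_prop))
      refine (h.norm).mono' hc.aestronglyMeasurable (Filter.Eventually.of_forall fun z => ?_)
      rw [map_mul, map_sum, EuclideanSpace.real_norm_sq_eq]
      simp only [map_pow, eval_X]
      rw [Real.norm_eq_abs, Real.norm_eq_abs, abs_mul (_ * _ * _), ← EuclideanSpace.real_norm_sq_eq]
      exact mul_le_of_le_one_right (abs_nonneg _) (Real.abs_cos_le_one _)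
    have hI2 : Integrable (fun z : EuclideanSpace ℝ (Fin 3) =>
        eval (WithLp.ofLp z) Y * Real.exp (-(a * ‖z‖ ^ 2)) * Real.cos (inner ℝ q z)) := by
      have h := integrable_eval_mul_exp Y ha
      have hc : Continuous fun z : EuclideanSpace ℝ (Fin 3) =>
          eval (WithLp.ofLp z) Y * Real.exp (-(a * ‖z‖ ^ 2)) * Real.cos (inner ℝ q z) :=
        (((Literature.Topology.FourManifolds.contDiff_mvPolynomial_eval_ofLp Y (N := 0)).continuous).mul
          (by fun_prop)).mul (by fun_prop)
      refine (h.norm).mono' hc.aestronglyMeasurable (Filter.Eventually.of_forall fun z => ?_)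
      rw [Real.norm_eq_abs, Real.norm_eq_abs, abs_mul]
      exact mul_le_of_le_one_right (abs_nonneg _) (Real.abs_cos_le_one _)
    simp_rw [hsplit]
    rw [integral_sub (hI1.const_mul _) (hI2.const_mul _), integral_const_mul, integral_const_mul, hS, hC]
    have ha' : a ≠ 0 := ha.ne'
    field_simp
    ring
  simp_rw [hΦ]
  rw [← integral_const_mul]
  refine integral_congr_ae (Filter.Eventually.of_forall fun p => ?_)
  ring

end Summit.QuantumFields.YangMills.Theorems.F4SubCurvatureDoorLaplacianGaussianSlices

end
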